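import Summits.BirchSwinnertonDyer.BirchSwinnertonDyer.Theorems.QuadraticBranchSignedControlPlusEtaLowerInclusionTamagawaRoad
import Summits.BirchSwinnertonDyer.BirchSwinnertonDyer.Theorems.Rank2ObservatoryTamagawaCert
import Literature.NumberTheory.EllipticCurves.QuadraticTwistJInvariantProofs
import Literature.NumberTheory.EllipticCurves.BSDSelmerSmithGoldfeldProofs
import HarnessLib

/-!
# Route `QuadraticBranchSignedControl` (rung K8, cell `bsd-potss`), crux `PlusEtaLowerInclusion`
# (item stmt-BirchSwinnertonDyer-19601): the RECORD SHAPE of the Tamagawa road on a census row —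
# (E⁺_η) ∧ (C1⁺_η) at every tower-onto good supersingular twist of an additive partner `W` given by
# its integral model, TWO TAMAGAWA-`p` PRIMES read off a kernel Tate certificate, `rank W(ℚ) ≤ 1`
# and the analytic certificate at `v = 1` (seat `bsd-potss-k8eta-c1` g4)

WHAT. `…TamagawaRoad` (p515151) proves (E⁺_η)(V,p) at a tower-onto pair from the named facts, the
certificates and the arithmetic input `v + r ≤ ∑_{ℓ ∈ T} ord_p c_ℓ(W)` (`ord_p c_ℓ(W) ≤ 1` on `T`).
THIS FILE turns that input into a KERNEL CHECK on the integral model `W₀` of `W`: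
* §1 `mordellWeilRank_quadraticTwist_eq_of_smul_quadraticTwist_eq`: `C • W^{(d)} = V ⟹
  rank V^{(d)}(ℚ) = rank W(ℚ)` (`(C • X)^{(d)} ≅ X^{(d)}`, `(W^{(d)})^{(d)} = W^{(d²)} ≅ W^{(1)} ≅ W`).
* §2 `tamagawa_inputs_of_rowCheck`: from a passing ROW CERTIFICATE of the rank-2 observatory
  (`TamLocal.rowCheck Es W₀`: Tate's algorithm at every bad prime as `decide`-able data, complete by
  `|Δ| = ∏ pⁿ`), `W₀ ⊗ ℚ` globally minimal, and a list `L` of listed primes with the Boolean side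
  conditions «every listed prime outside `L` is `p` or has all certified values prime to `p`» and
  «every prime of `L` has the exact certified value `c` with `ord_p c = 1`»: with `T = pl(L)`,
  `pl p ∉ T`, every place `v ≠ pl p` with `p ∣ c_v(W)` lies in `T`, `ord_p c_w(W) ≤ 1` on `T`, and
  `∑_{w ∈ T} ord_p c_w(W) = |L|`.
* §3 **`etaPair_of_rowCheck_of_tamagawaPair`** — THE RECORD SHAPE: named facts (Kobayashi
  1.2/1.3/2.2η/4.1η, Kitajima–Otsuki 1.3η, Poitou–Tate) + `p ≥ 5` + a passing row certificate with
  `|L| = 2` + global minimality of `W₀ ⊗ ℚ` + **`rank W(ℚ) ≤ 1`** (DISPLAYED; = GZK on a rank-one row) +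
  for the twist `V` (`C • (W₀ ⊗ ℚ)^{(p*)} = V`, good at `p`, `a_p = 0`): tower onto, the `V`-certificate
  and the ANALYTIC certificate `p² ∤ coeff_r L_p⁺(V,η,T)` ⟹ **(E⁺_η)(V,p) ∧ (C1⁺_η)(V,p)**.
The per-row records (`…PlusEtaR1TamagawaRows*.lean`) instantiate §3 on the 13 rank-one tower-onto
census rows of g3's table with two Tamagawa-`5` primes.

HONEST FRAMING (cell `bsd-potss`, run/shared/lean/pub/bsd-potss/; FULL-BSD rank ≤ 1 programme, HUMAN
RULING D-0036/D-0074/D-0088(2)): TOOL THEOREMS ONLY, CONDITIONAL on the named Literature facts in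
hypothesis position and on DISPLAYED per-pair inputs (`rank W(ℚ) ≤ 1`; on the twist: tower onto, the
`V`-certificate, the analytic certificate — kit evidence, kernel for NO row). The crux 19601 is OPEN and
NOT closed; nothing is booked; `BSD(W, p)` is claimed for no pair. No definition, no named fact, no
`sorry`, axioms standard. `--supports stmt-BirchSwinnertonDyer-19601`.

References: [Kobayashi2003] Thm. 2.2 (p. 5), §4 + Thm. 4.1 (p. 8); [KitajimaOtsuki2018] Thm. 1.3;
[MilneADT2006] I Thm. 4.10; [SilvermanATAEC1994] IV.9.4 (Tate's algorithm); [SilvermanAEC2009]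
III.3.1(b), VII.5 Prop. 5.1, X.5.
-/

set_option autoImplicit false
set_option linter.dupNamespace false

noncomputable section

open scoped Classical NumberField

open CongruenceSubgroup Field NumberField IsDedekindDomain WeierstrassCurve Rat.HeightOneSpectrum
open Literature.NumberTheory.EllipticCurves
open Literature.NumberTheory.EllipticCurves.ModularForms
open Literature.NumberTheory.GaloisRepresentations
open Literature.NumberTheory.GaloisCohomology
open Summit.BirchSwinnertonDyer.Rank1Residual.Additive
open Summit.BirchSwinnertonDyer.BirchSwinnertonDyer.Rank2Observatory.Tam

namespace Summit.BirchSwinnertonDyer.BirchSwinnertonDyer.Theorems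

namespace TamagawaRoad

/-! ## §1 `rank V^{(d)}(ℚ) = rank W(ℚ)` for `C • W^{(d)} = V` -/

/-- **`C • W^{(d)} = V ⟹ rank V^{(d)}(ℚ) = rank W(ℚ)`** (`d ≠ 0`): `V^{(d)} = (C • W^{(d)})^{(d)} ≅
(W^{(d)})^{(d)} = W^{(d·d)} = W^{(1·d²)} ≅ W^{(1)} ≅ W`, and the Mordell–Weil rank is invariant under
admissible changes of variables. [cite: SilvermanAEC2009, III.3.1(b) and X.5 Cor. 5.4.1] -/
theorem mordellWeilRank_quadraticTwist_eq_of_smul_quadraticTwist_eq {W V : WeierstrassCurve ℚ}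
    {C : VariableChange ℚ} {d : ℚ} (hd : d ≠ 0) (hCV : C • W.quadraticTwist d = V) :
    (V.quadraticTwist d).mordellWeilRank = W.mordellWeilRank := by
  rw [← hCV, WeierstrassCurve.quadraticTwist_smul, WeierstrassCurve.mordellWeilRank_variableChange_holds,
    quadraticTwist_quadraticTwist, show d * d = 1 * d ^ 2 by ring,
    mordellWeilRank_quadraticTwist_mul_sq W 1 d hd]
  obtain ⟨C', hC'⟩ := W.exists_variableChange_quadraticTwist_one
  rw [← hC', WeierstrassCurve.mordellWeilRank_variableChange_holds]

/-! ## §2 From a kernel row certificate to the Tamagawa inputs of the road -/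

/-- `pl p` is the place `primesEquiv.symm ⟨p, _⟩` of the road's statements. [folklore] -/
theorem pl_eq_primesEquiv_symm (p : ℕ) [hp : Fact p.Prime] :
    pl p = (Rat.HeightOneSpectrum.primesEquiv (R := 𝓞 ℚ)).symm ⟨p, hp.out⟩ := by
  rw [pl, dif_pos hp.out]

/-- **The Tamagawa inputs of the road from a ROW CERTIFICATE.** For an integer equation `W₀` with a
passing row certificate `Es` (`TamLocal.rowCheck`), `W₀ ⊗ ℚ` globally minimal, a prime `p` and a list
`L` of naturals such that (Boolean, `decide`-able on the data) every `E ∈ Es` with `E.p ∉ L` has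
`E.p = p` or all its certified values prime to `p`, and every `E ∈ Es` with `E.p ∈ L` has the exact
value set `[E.c]` with `p ∥ E.c` (`p ∣ E.c`, `p² ∤ E.c`); `L ⊆` the listed primes, `L` without duplicates, `p ∉ L`. Then
with `T = (L.map pl).toFinset`: `pl p ∉ T`; every place `v ≠ pl p` with `p ∣ c_v(W₀ ⊗ ℚ)` lies in `T`
(unlisted places have `c_v = 1`); `ord_p c_w ≤ 1` on `T`; and `∑_{w ∈ T} ord_p c_w = |L|`.
[cite: SilvermanATAEC1994, IV.9.4] [cite: SilvermanAEC2009, VII.5 Prop. 5.1] -/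
theorem tamagawa_inputs_of_rowCheck {Es : List TamLocal} {W₀ : WeierstrassCurve ℤ}
    (h : TamLocal.rowCheck Es W₀ = true) (hGM : (W₀.baseChange ℚ).IsGloballyMinimal)
    (p : ℕ) [hp : Fact p.Prime] (L : List ℕ)
    (hout : ∀ E ∈ Es, E.p ∉ L → E.p = p ∨ ∀ c ∈ E.vals, ¬ p ∣ c)
    (hin : ∀ E ∈ Es, E.p ∈ L → E.vals = [E.c] ∧ p ∣ E.c ∧ ¬ p ^ 2 ∣ E.c)
    (hL : ∀ ℓ ∈ L, ℓ ∈ Es.map (·.p)) (hnd : L.Nodup) (hpL : p ∉ L) :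
    pl p ∉ (L.map pl).toFinset ∧
      (∀ v : HeightOneSpectrum (𝓞 ℚ), v ≠ pl p → p ∣ tam W₀ v → v ∈ (L.map pl).toFinset) ∧
      (∀ w ∈ (L.map pl).toFinset, padicValNat p (tam W₀ w) ≤ 1) ∧
      ∑ w ∈ (L.map pl).toFinset, padicValNat p (tam W₀ w) = L.length := by
  have hprimeL : ∀ ℓ ∈ L, ℓ.Prime := fun ℓ hℓ ↦ TamLocal.prime_of_mem_map h (hL ℓ hℓ)
  -- `pl` is injective on `L ∪ {p}`
  have hmemT : ∀ v : HeightOneSpectrum (𝓞 ℚ), v ∈ (L.map pl).toFinset ↔ natGenerator v ∈ L := by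
    intro v
    rw [List.mem_toFinset, List.mem_map]
    constructor
    · rintro ⟨ℓ, hℓ, rfl⟩
      rw [natGenerator_pl (hprimeL ℓ hℓ)]
      exact hℓ
    · intro hv
      exact ⟨natGenerator v, hv, pl_natGenerator v⟩
  -- the value at a place of `T`
  have hval : ∀ w ∈ (L.map pl).toFinset, padicValNat p (tam W₀ w) = 1 := by
    intro w hw
    have hwL := (hmemT w).mp hw
    obtain ⟨E, hE, hEp⟩ := List.mem_map.mp (hL _ hwL)
    obtain ⟨hvals, hc1, hc2⟩ := hin E hE (hEp ▸ hwL)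
    have hmem := TamLocal.tam_mem_vals_of_mem h hGM hE w hEp.symm
    rw [hvals, List.mem_singleton] at hmem
    have hc0 : E.c ≠ 0 := fun h0 ↦ hc2 (by rw [h0]; exact dvd_zero _)
    rw [hmem]
    refine le_antisymm ?_ (one_le_padicValNat_of_dvd hc0 hc1)
    by_contra hlt
    exact hc2 ((padicValNat_dvd_iff_le hc0).mpr (by omega))
  refine ⟨?_, ?_, fun w hw ↦ (hval w hw).le, ?_⟩
  · rw [hmemT, natGenerator_pl hp.out]
    exact hpL
  · intro v hv hdvd
    rw [hmemT]
    by_contra hvL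
    by_cases hlisted : natGenerator v ∈ Es.map (·.p)
    · obtain ⟨E, hE, hEp⟩ := List.mem_map.mp hlisted
      rcases hout E hE (hEp ▸ hvL) with hEp' | hcop
      · exact hv (by rw [← pl_natGenerator v, ← hEp, hEp'])
      · exact hcop _ (TamLocal.tam_mem_vals_of_mem h hGM hE v hEp.symm) hdvd
    · rw [TamLocal.tam_eq_one_of_not_mem h v hlisted] at hdvd
      exact hp.out.one_lt.ne' (Nat.dvd_one.mp hdvd)
  · rw [Finset.sum_congr rfl hval, Finset.sum_const, smul_eq_mul, mul_one, List.card_toFinset,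
      List.Nodup.dedup]
    · exact List.length_map _
    · exact (List.nodup_map_iff_inj_on hnd).mpr fun a ha b hb hab ↦ by
        rw [← natGenerator_pl (hprimeL a ha), hab, natGenerator_pl (hprimeL b hb)]

end TamagawaRoad

/-! ## §3 The record shape -/

section Shape

variable {p : ℕ} [hp : Fact p.Prime]

/-- **RECORD SHAPE — (E⁺_η) ∧ (C1⁺_η) on a Tamagawa row.** GRANTED the named facts (Kobayashi
1.2/1.3/2.2η/4.1η, Kitajima–Otsuki 1.3η, Poitou–Tate), `p ≥ 5`, an integer equation `W₀` with a PASSING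
ROW CERTIFICATE `Es` and a list `L` of TWO listed primes `≠ p` carrying the exact certified values `c` with
`p ∥ c`, every other listed prime `≠ p` having certified values prime to `p` (all `decide`-able),
`W = W₀ ⊗ ℚ` globally minimal with **`rank W(ℚ) ≤ 1`** (DISPLAYED): for every globally minimal `V`
with `C • W^{(p*)} = V`, good at `p`, `a_p(V) = 0`, `ρ_{V,p^m}` onto, the `V`-certificate and the
ANALYTIC certificate `p² ∤ coeff_r L_p⁺(V,η,T)`: **(E⁺_η)(V,p) ∧ (C1⁺_η)(V,p)** (`…TamagawaRoad` §3
with `T = pl(L)`, `v = 1`, `r = rank W ≤ 1 ≤ 2 − 1`). CONDITIONAL; closes nothing class-wide.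
[cite: Kobayashi2003, Thm. 2.2 (p. 5), §4 Even main conjecture and Thm. 4.1 (p. 8)]
[cite: KitajimaOtsuki2018, Thm. 1.3] [cite: MilneADT2006, Ch. I, Thm. 4.10] [cite: SilvermanATAEC1994, IV.9.4] -/
theorem etaPair_of_rowCheck_of_tamagawaPair
    (h12 : Kobayashi2003.thm12_signedSelmerDual_finite_torsion)
    (h13 : Kobayashi2003.thm41_signedCharIdeal_divisibility)
    (h22 : Kobayashi2003.thm22_etaSignedSelmerDual_finite_torsion)
    (h41 : Kobayashi2003.thm41_plusEtaCharIdeal_dvd)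
    (hKO : KitajimaOtsuki2018.mainThm13_etaSignedSelmerDual_noFiniteSubmodule)
    (hPT : poitouTate_selmerStructure_duality_real ℚ) (hp5 : 5 ≤ p)
    {Es : List TamLocal} {W₀ : WeierstrassCurve ℤ} (hrow : TamLocal.rowCheck Es W₀ = true)
    (L : List ℕ) (hout : ∀ E ∈ Es, E.p ∉ L → E.p = p ∨ ∀ c ∈ E.vals, ¬ p ∣ c)
    (hin : ∀ E ∈ Es, E.p ∈ L → E.vals = [E.c] ∧ p ∣ E.c ∧ ¬ p ^ 2 ∣ E.c)
    (hL : ∀ ℓ ∈ L, ℓ ∈ Es.map (·.p)) (hnd : L.Nodup) (hpL : p ∉ L) (hlen : L.length = 2)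
    [(W₀.baseChange ℚ).IsElliptic] [hGM : (W₀.baseChange ℚ).IsGloballyMinimal]
    (hrW : (W₀.baseChange ℚ).mordellWeilRank ≤ 1)
    (V : WeierstrassCurve ℚ) [V.IsElliptic] [V.IsGloballyMinimal] (C : VariableChange ℚ)
    (hCV : C • (W₀.baseChange ℚ).quadraticTwist ((-1) ^ (p / 2) * p) = V)
    (hgood : V.HasGoodReductionAtPrime p) (hap : V.frobeniusTrace p = 0)
    (hsurj : ∀ m : ℕ, V.HasSurjectiveModNGaloisRep (p ^ m : ℕ))
    (hcertV : ∀ {N : ℕ} [NeZero N] (f : CuspForm (Gamma0 N) 2), IsNewformOf V f →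
      ∃ L : IwasawaAlgebra p, Kobayashi2003.IsSignedPAdicLFunction f p 1 L ∧
        IsUnit (PowerSeries.coeff V.mordellWeilRank L))
    (han : ∀ {N : ℕ} [NeZero N] {f : CuspForm (Gamma0 N) 2}, IsNewformOf V f →
      ∀ (ϖ : ℚ), (if Even (p / 2) then (ϖ : ℝ) * V.realPeriodRat = plusPeriod f
          else (ϖ : ℝ) * V.imaginaryPeriodRat = minusPeriod f) →
      ∀ (Lη : IwasawaAlgebra p), IsQuadraticBranchPlusLFunction f p ϖ Lη →
        ¬ (p : ℤ_[p]) ^ 2 ∣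
          PowerSeries.coeff (V.quadraticTwist ((-1) ^ (p / 2) * p)).mordellWeilRank Lη) :
    QuadraticBranchPlusEtaLowerInclusionAt V p ∧ QuadraticBranchPlusEtaMainConjectureAt V p := by
  obtain ⟨hpT, hT, hT1, hsum⟩ := TamagawaRoad.tamagawa_inputs_of_rowCheck hrow hGM p L hout hin hL hnd hpL
  have hd : ((-1 : ℚ) ^ (p / 2) * p) ≠ 0 :=
    mul_ne_zero (pow_ne_zero _ (by norm_num)) (Nat.cast_ne_zero.mpr hp.out.ne_zero)
  have hr : (V.quadraticTwist ((-1) ^ (p / 2) * p)).mordellWeilRank ≤ 1 := by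
    rw [TamagawaRoad.mordellWeilRank_quadraticTwist_eq_of_smul_quadraticTwist_eq hd hCV]
    exact hrW
  rw [TamagawaRoad.pl_eq_primesEquiv_symm p] at hpT hT
  exact quadraticBranchPlusEta_lowerInclusion_and_mainConjectureAt_of_namedFacts_of_poitouTate_of_tamagawa
    h12 h13 h22 h41 hKO hPT hp5 hgood hap hsurj (fun f hf => hcertV f hf) (W₀.baseChange ℚ) C hCV
    ((L.map pl).toFinset) hpT hT hT1 1 (by rw [hsum, hlen]; omega) (fun hf => han hf)

end Shape

end Summit.BirchSwinnertonDyer.BirchSwinnertonDyer.Theorems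

end
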